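import Literature.IUT.LogVolume.GenuineLogThetaPerImageStepV
import Literature.IUT.LogVolume.TensorPacketOrbitVolume
import HarnessLib

/-!
# The EXACT value of `−|log(Θ)|_p` at a real prime packet: an affine function of finitely many content integers
# (Dupuy–Hilado §4.9–4.12 with the FULL (Ind2) group; [IUTchIV] Prop. 1.4; [IUTchIII] Cor. 3.12)

Record/proof-only file of the abc-iut cell (Cor. 3.12 crew, L-DH lane, seat abc-iut-c312-3; item «XXVIIc-DH»
of `HOME/skel/FORK-INDEX.md` row 2, DH-GLOBAL column; packet level — the input level is the sequel
`GenuineLogThetaExactVolumeInput.lean`). TAKES NO SIDE on [IUTchIII] Cor. 3.12.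

The Literature-level `−|log(Θ)|_p` (`PrimePacket.negLogThetaAt`, `GenuineLogTheta.lean`: sharp (Ind3)-datum
`O_𝕃(−div t)_p`, (Ind1) = all slot permutations, (Ind2) = `Aut_{ℚ_p}(V : log_p(R_I^×))`, hull = `(R_I)^∼`-span,
Dupuy–Hilado's weights `Π Pr(v_b)` and procession average) was so far BRACKETED in the tree (free inequality below,
[IUTchIV] Thm. 1.10 Step (v) above: abc-iut-c312-d1's `realPrimePacketWith_stepV`). With abc-iut-w5-d180's
orbit-content algebra (`TensorPacketOrbitContent` / `TensorPacketOrbitVolume`: the hull of the (Ind2)-orbit of a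
bounded region `M ∌` only `0` is `hull(p^m·log_p(R_I^×))` for the CONTENT `m` of `M`, of log-volume
`−m·log p + log μ̄(hull(log_p(R_I^×)))`) it is here computed EXACTLY, for the real packet `realPrimePacketWith p 𝔽 c`
with ANY shell normalisation `c` (Dupuy–Hilado's `realPrimePacket` and Mochizuki's `realPrimePacketM` alike — the
shell never enters, `realPrimePacketWith_negLogThetaAt_indep_shell`):

* `realPrimePacketWith_indOneUnion_pilotRegion_eq_slotUnion` — at the summand `v⃗ = e` of degree `j = i+1 ≤ ℓ⋇` the
  (Ind1)-union of the sharp datum is the SLOT UNION `M(i,v⃗) = ⋃_{a ∈ I} ι_a(t_{i,v_a})·(R_I)^∼`;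
* `realPrimePacketWith_possibleImages_pilotRegion_eq` — the possible images are the (Ind2)-orbit of `M(i,v⃗)`;
* **`realPrimePacketWith_exists_content_logμ_possibleImagesHull`** — there is an integer `m` (the content of
  `M(i,v⃗)` w.r.t. `log_p(R_I^×)`: `M ⊆ p^m·log_p(R_I^×)`, `M ⊄ p^{m+1}·log_p(R_I^×)`) with `hull(possible images)_{v⃗} =
  hull(p^m·log_p(R_I^×))`, admissible, of log-volume `−m·log p + log μ̄(hull(log_p(R_I^×)))`;
* **`realPrimePacketWith_negLogThetaAt_eq_of_content`** — hence, for ANY family `m(i,v⃗)` of contents,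
  `−|log(Θ)|_p = (1/ℓ⋇)·Σ_{i<ℓ⋇} Σ_{v⃗ ∈ 𝕍_p^{i+2}} (−m(i,v⃗)·log p + log μ̄(hull(log_p(R_{v⃗}^×))))·Π_b Pr(v_b)`;
  such a family EXISTS (`exists_slotUnion_contentFamily`) and is UNIQUE (`slotUnion_contentFamily_unique`).

So with the full (Ind2) group the number `−|log(Θ)|_p` depends on the Θ-idele ONLY through finitely many integers;
the window each `m(i,v⃗)` sits in (`⌊λ_min − d_I − a_I⌋ ≤ m`, `m·log p ≤ b_I·log p − log‖t‖`) is abc-iut-w5-d082's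
`TensorPacketContentBounds` (not used here). [cite: DupuyHilado2025, §3.9, §4.7, §4.9, §4.11, §4.12]
[cite: WeilBNT1967, Ch. II §2, Th. 2] [cite: Mochizuki2012, IUTchIV Thm. 1.10 Step (v)–(vi) p. 27–29]
[claim: Mochizuki2012, status: disputed] HONEST SCOPE: (Ind2)/the hull are the tree's typings of disputed-corpus
constructions; the lattice algebra is classical; nothing about [IUTchIII] Cor. 3.12 is asserted.
PROOF-ONLY file: no definitions, no named `Prop` facts; typed ≠ proved.
-/

noncomputable section

open Set Module
open scoped Pointwise TensorProduct

namespace Literature.IUT.LogVolume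

/-! ## Packet level: the real packet with any shell normalisation -/

section RealPacketWith

variable {F : Type} [Field F] [NumberField F]
variable (p : ℕ) [Fact p.Prime] (𝔽 : LocalFields F p)
variable (c : (j : ℕ) → (Fin (j + 1) → placesOver F p) → ℚ_[p]) (hc0 : ∀ j e, c j e ≠ 0)
  (hcσ : ∀ (j : ℕ) (σ : Equiv.Perm (Fin (j + 1))) (e : Fin (j + 1) → placesOver F p), c j (e ∘ σ) = c j e)

/-- The number `−|log(Θ)|_p` of the real packet does NOT depend on the shell scalar `c` (Dupuy–Hilado's `I_{v⃗}`
vs Mochizuki's container): the shell enters (Ind3)-admissibility only, never the sharp datum, the indeterminacies,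
the hull or the measure. [cite: DupuyHilado2025, §4 (intro), §4.10] -/
theorem realPrimePacketWith_negLogThetaAt_indep_shell
    (c' : (j : ℕ) → (Fin (j + 1) → placesOver F p) → ℚ_[p]) (hc0' : ∀ j e, c' j e ≠ 0)
    (hcσ' : ∀ (j : ℕ) (σ : Equiv.Perm (Fin (j + 1))) (e : Fin (j + 1) → placesOver F p), c' j (e ∘ σ) = c' j e)
    {lstar : ℕ} (t : Fin lstar → (v : placesOver F p) → (𝔽.k v)ˣ) :
    (realPrimePacketWith p 𝔽 c hc0 hcσ).negLogThetaAt lstar t =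
      (realPrimePacketWith p 𝔽 c' hc0' hcσ').negLogThetaAt lstar t := rfl

/-- In particular Dupuy–Hilado's and Mochizuki's normalisations give the same `−|log(Θ)|_p`.
[cite: DupuyHilado2025, §4 (intro)] [cite: Mochizuki2012, IUTchIV Prop. 1.2 (ii) p. 10] -/
theorem realPrimePacketM_negLogThetaAt_eq_realPrimePacket {lstar : ℕ}
    (t : Fin lstar → (v : placesOver F p) → (𝔽.k v)ˣ) :
    (realPrimePacketM p 𝔽).negLogThetaAt lstar t = (realPrimePacket p 𝔽).negLogThetaAt lstar t := rfl

/-- **The (Ind1)-union of the sharp datum at a summand is the SLOT UNION**: for the degree `j = i+1 ≤ ℓ⋇` and the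
collection `v⃗ = e`, `⋃_σ perm_σ(O_𝕃(−div t)_{v⃗∘σ}) = ⋃_{a} ι_a(t_{i,v_a})·(R_I)^∼` (each permuted bare region is
the twist through the slot `σ(j)`; every slot `a` is reached by the transposition `(a j)`).
[cite: DupuyHilado2025, §3.9, §4.7] -/
theorem realPrimePacketWith_indOneUnion_pilotRegion_eq_slotUnion {lstar : ℕ}
    (t : Fin lstar → (v : placesOver F p) → (𝔽.k v)ˣ) (i : Fin lstar)
    (e : Fin ((i : ℕ) + 1 + 1) → placesOver F p) :
    (⋃ σ : Equiv.Perm (Fin ((i : ℕ) + 1 + 1)), (realPrimePacketWith p 𝔽 c hc0 hcσ).perm σ e ''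
        (realPrimePacketWith p 𝔽 c hc0 hcσ).pilotRegion t ((i : ℕ) + 1) (e ∘ σ)) =
      ⋃ a : Fin ((i : ℕ) + 1 + 1), iota p (fun b => 𝔽.k (e b)) a (t i (e a) : 𝔽.k (e a)) •
        (normalizedPacket p (fun b => 𝔽.k (e b)) : Set (PacketAlgebra p (fun b => 𝔽.k (e b)))) := by
  have hσ : ∀ σ : Equiv.Perm (Fin ((i : ℕ) + 1 + 1)), (realPrimePacketWith p 𝔽 c hc0 hcσ).perm σ e ''
      (realPrimePacketWith p 𝔽 c hc0 hcσ).pilotRegion t ((i : ℕ) + 1) (e ∘ σ) =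
        iota p (fun b => 𝔽.k (e b)) (σ (Fin.last _)) (t i (e (σ (Fin.last _))) : 𝔽.k (e (σ (Fin.last _)))) •
          (normalizedPacket p (fun b => 𝔽.k (e b)) : Set (PacketAlgebra p (fun b => 𝔽.k (e b)))) := by
    intro σ
    rw [PrimePacket.pilotRegion_succ_eq]
    exact realPrimePacketWith_perm_image_bare p 𝔽 c hc0 hcσ σ e (t i (e (σ (Fin.last _))))
  apply Set.Subset.antisymm
  · refine Set.iUnion_subset fun σ => ?_
    rw [hσ σ]
    exact Set.subset_iUnion (fun a : Fin ((i : ℕ) + 1 + 1) => iota p (fun b => 𝔽.k (e b)) a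
      (t i (e a) : 𝔽.k (e a)) • (normalizedPacket p (fun b => 𝔽.k (e b)) :
        Set (PacketAlgebra p (fun b => 𝔽.k (e b))))) (σ (Fin.last _))
  · refine Set.iUnion_subset fun a => ?_
    obtain ⟨σ, hσa⟩ : ∃ σ : Equiv.Perm (Fin ((i : ℕ) + 1 + 1)), σ (Fin.last _) = a :=
      ⟨Equiv.swap a (Fin.last _), Equiv.swap_apply_right _ _⟩
    subst hσa
    rw [← hσ σ]
    exact Set.subset_iUnion (fun τ : Equiv.Perm (Fin ((i : ℕ) + 1 + 1)) =>
      (realPrimePacketWith p 𝔽 c hc0 hcσ).perm τ e ''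
        (realPrimePacketWith p 𝔽 c hc0 hcσ).pilotRegion t ((i : ℕ) + 1) (e ∘ τ)) σ

/-- **The possible images at a summand are the (Ind2)-orbit of the (Ind1)-union** (`g·` distributes over the
union over `σ`). [cite: DupuyHilado2025, §4.9, §4.11] -/
theorem realPrimePacketWith_possibleImages_eq_orbit {j : ℕ} (e : Fin (j + 1) → placesOver F p)
    (B : (realPrimePacketWith p 𝔽 c hc0 hcσ).Region) :
    (realPrimePacketWith p 𝔽 c hc0 hcσ).possibleImages B j e =
      ⋃ g : (realPrimePacketWith p 𝔽 c hc0 hcσ).G₂ j e,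
        g • ⋃ σ : Equiv.Perm (Fin (j + 1)), (realPrimePacketWith p 𝔽 c hc0 hcσ).perm σ e '' B j (e ∘ σ) := by
  simp only [PrimePacket.possibleImages, Set.smul_set_iUnion]

/-- The possible images of the SHARP datum at a summand of degree `j = i+1 ≤ ℓ⋇` are the (Ind2)-orbit of the slot
union `⋃_a ι_a(t_{i,v_a})·(R_I)^∼`. [cite: DupuyHilado2025, §4.11] -/
theorem realPrimePacketWith_possibleImages_pilotRegion_eq {lstar : ℕ}
    (t : Fin lstar → (v : placesOver F p) → (𝔽.k v)ˣ) (i : Fin lstar)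
    (e : Fin ((i : ℕ) + 1 + 1) → placesOver F p) :
    (realPrimePacketWith p 𝔽 c hc0 hcσ).possibleImages
        ((realPrimePacketWith p 𝔽 c hc0 hcσ).pilotRegion t) ((i : ℕ) + 1) e =
      ⋃ g : indTwo p (fun b => 𝔽.k (e b)),
        g • ⋃ a : Fin ((i : ℕ) + 1 + 1), iota p (fun b => 𝔽.k (e b)) a (t i (e a) : 𝔽.k (e a)) •
          (normalizedPacket p (fun b => 𝔽.k (e b)) : Set (PacketAlgebra p (fun b => 𝔽.k (e b)))) := by
  rw [realPrimePacketWith_possibleImages_eq_orbit,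
    realPrimePacketWith_indOneUnion_pilotRegion_eq_slotUnion]
  rfl

/-- The slot union is bounded (each `ι_a(t)·(R_I)^∼` is a bounded translate). [cite: DupuyHilado2025, §4.12] -/
theorem isPsiBounded_slotUnion {lstar : ℕ} (t : Fin lstar → (v : placesOver F p) → (𝔽.k v)ˣ)
    (i : Fin lstar) (e : Fin ((i : ℕ) + 1 + 1) → placesOver F p) :
    IsPsiBounded p (fun b => 𝔽.k (e b))
      (⋃ a : Fin ((i : ℕ) + 1 + 1), iota p (fun b => 𝔽.k (e b)) a (t i (e a) : 𝔽.k (e a)) •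
        (normalizedPacket p (fun b => 𝔽.k (e b)) : Set (PacketAlgebra p (fun b => 𝔽.k (e b))))) :=
  isPsiBounded_iUnion p (fun b => 𝔽.k (e b)) fun a =>
    isPsiBounded_smul_normalizedPacket p (fun b => 𝔽.k (e b))
      (iota p (fun b => 𝔽.k (e b)) a (t i (e a) : 𝔽.k (e a)))

/-- The slot union contains the nonzero vector `ι_j(t_{i,v_j}) = ι_j(t_{i,v_j})·1`. [cite: DupuyHilado2025, §3.7] -/
theorem exists_ne_zero_mem_slotUnion {lstar : ℕ} (t : Fin lstar → (v : placesOver F p) → (𝔽.k v)ˣ)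
    (i : Fin lstar) (e : Fin ((i : ℕ) + 1 + 1) → placesOver F p) :
    ∃ x ∈ (⋃ a : Fin ((i : ℕ) + 1 + 1), iota p (fun b => 𝔽.k (e b)) a (t i (e a) : 𝔽.k (e a)) •
        (normalizedPacket p (fun b => 𝔽.k (e b)) : Set (PacketAlgebra p (fun b => 𝔽.k (e b))))), x ≠ 0 := by
  refine ⟨iota p (fun b => 𝔽.k (e b)) (Fin.last _) (t i (e (Fin.last _)) : 𝔽.k (e (Fin.last _))), ?_, ?_⟩
  · refine Set.mem_iUnion.mpr ⟨Fin.last _, ?_⟩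
    have h := Set.smul_mem_smul_set (a := iota p (fun b => 𝔽.k (e b)) (Fin.last _)
      (t i (e (Fin.last _)) : 𝔽.k (e (Fin.last _))))
      (Subring.one_mem (normalizedPacket p (fun b => 𝔽.k (e b))) : (1 : PacketAlgebra p (fun b => 𝔽.k (e b))) ∈
        (normalizedPacket p (fun b => 𝔽.k (e b)) : Set (PacketAlgebra p (fun b => 𝔽.k (e b)))))
    rwa [smul_eq_mul, mul_one] at h
  · exact (map_ne_zero (iota p (fun b => 𝔽.k (e b)) (Fin.last _))).mpr (t i (e (Fin.last _))).ne_zero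

/-- **The Θ-hull at a summand and its EXACT log-volume.** For the sharp datum of the theta idele `t` in the real
packet (any shell), at every degree `j = i+1 ≤ ℓ⋇` and collection `v⃗ = e` there is an integer `m` — the content of
the slot union `M = ⋃_a ι_a(t_{i,v_a})·(R_I)^∼` w.r.t. `log_p(R_I^×)` (`M ⊆ p^m·log_p(R_I^×)`, `M ⊄ p^{m+1}·log_p(R_I^×)`)
— such that the hull of the possible images at `v⃗` is `hull(p^m·log_p(R_I^×))`, admissible, of log-volume
`−m·log p + log μ̄(hull(log_p(R_I^×)))`. [cite: DupuyHilado2025, §4.9, §4.12] [cite: WeilBNT1967, Ch. II §2, Th. 2] -/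
theorem realPrimePacketWith_exists_content_logμ_possibleImagesHull {lstar : ℕ}
    (t : Fin lstar → (v : placesOver F p) → (𝔽.k v)ˣ) (i : Fin lstar)
    (e : Fin ((i : ℕ) + 1 + 1) → placesOver F p) :
    ∃ m : ℤ,
      (⋃ a : Fin ((i : ℕ) + 1 + 1), iota p (fun b => 𝔽.k (e b)) a (t i (e a) : 𝔽.k (e a)) •
          (normalizedPacket p (fun b => 𝔽.k (e b)) : Set (PacketAlgebra p (fun b => 𝔽.k (e b))))) ⊆
        ((p : ℚ_[p]) ^ m) • (logPacket p (fun b => 𝔽.k (e b)) : Set (PacketAlgebra p (fun b => 𝔽.k (e b)))) ∧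
      ¬ (⋃ a : Fin ((i : ℕ) + 1 + 1), iota p (fun b => 𝔽.k (e b)) a (t i (e a) : 𝔽.k (e a)) •
          (normalizedPacket p (fun b => 𝔽.k (e b)) : Set (PacketAlgebra p (fun b => 𝔽.k (e b))))) ⊆
        ((p : ℚ_[p]) ^ (m + 1)) • (logPacket p (fun b => 𝔽.k (e b)) : Set (PacketAlgebra p (fun b => 𝔽.k (e b)))) ∧
      (realPrimePacketWith p 𝔽 c hc0 hcσ).possibleImagesHull
          ((realPrimePacketWith p 𝔽 c hc0 hcσ).pilotRegion t) ((i : ℕ) + 1) e =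
        packetHull p (fun b => 𝔽.k (e b)) (((p : ℚ_[p]) ^ m) •
          (logPacket p (fun b => 𝔽.k (e b)) : Set (PacketAlgebra p (fun b => 𝔽.k (e b))))) ∧
      (realPrimePacketWith p 𝔽 c hc0 hcσ).adm ((realPrimePacketWith p 𝔽 c hc0 hcσ).possibleImagesHull
          ((realPrimePacketWith p 𝔽 c hc0 hcσ).pilotRegion t) ((i : ℕ) + 1) e) ∧
      (realPrimePacketWith p 𝔽 c hc0 hcσ).logμ ((realPrimePacketWith p 𝔽 c hc0 hcσ).possibleImagesHull
          ((realPrimePacketWith p 𝔽 c hc0 hcσ).pilotRegion t) ((i : ℕ) + 1) e) =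
        -(m * Real.log p) + packetLogμ p (fun b => 𝔽.k (e b))
          (packetHull p (fun b => 𝔽.k (e b))
            (logPacket p (fun b => 𝔽.k (e b)) : Set (PacketAlgebra p (fun b => 𝔽.k (e b))))) := by
  obtain ⟨m, hm, hm1⟩ := exists_content p (fun b => 𝔽.k (e b)) (isPsiBounded_slotUnion p 𝔽 t i e)
    (exists_ne_zero_mem_slotUnion p 𝔽 t i e)
  obtain ⟨x, hxM, hx⟩ := Set.not_subset.mp hm1
  have hhull : (realPrimePacketWith p 𝔽 c hc0 hcσ).possibleImagesHull
      ((realPrimePacketWith p 𝔽 c hc0 hcσ).pilotRegion t) ((i : ℕ) + 1) e =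
        packetHull p (fun b => 𝔽.k (e b)) (((p : ℚ_[p]) ^ m) •
          (logPacket p (fun b => 𝔽.k (e b)) : Set (PacketAlgebra p (fun b => 𝔽.k (e b))))) := by
    change packetHull p (fun b => 𝔽.k (e b)) ((realPrimePacketWith p 𝔽 c hc0 hcσ).possibleImages
      ((realPrimePacketWith p 𝔽 c hc0 hcσ).pilotRegion t) ((i : ℕ) + 1) e) = _
    rw [realPrimePacketWith_possibleImages_pilotRegion_eq]
    exact packetHull_orbit_eq_zpow p (fun b => 𝔽.k (e b)) hxM hx hm
  refine ⟨m, hm, hm1, hhull, ?_, ?_⟩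
  · rw [hhull]
    exact packetAdm_packetHull_zpow_smul_logPacket p (fun b => 𝔽.k (e b)) m
  · rw [hhull]
    exact packetLogμ_packetHull_zpow_smul_logPacket p (fun b => 𝔽.k (e b)) m

/-- **`−|log(Θ)|_p` in terms of ANY family of contents**: if `m(i,v⃗)` is the content of the slot union at every
summand (`j = i+1 ≤ ℓ⋇`, `v⃗ ∈ 𝕍_p^{j+1}`), then
`−|log(Θ)|_p = (1/ℓ⋇)·Σ_i Σ_{v⃗} (−m(i,v⃗)·log p + log μ̄(hull(log_p(R_{v⃗}^×))))·Π_b Pr(v_b)`.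
[cite: DupuyHilado2025, Def. 3.6.3, §4.12] -/
theorem realPrimePacketWith_negLogThetaAt_eq_of_content {lstar : ℕ}
    (t : Fin lstar → (v : placesOver F p) → (𝔽.k v)ˣ)
    (m : (i : Fin lstar) → (Fin ((i : ℕ) + 1 + 1) → placesOver F p) → ℤ)
    (hm : ∀ (i : Fin lstar) (e : Fin ((i : ℕ) + 1 + 1) → placesOver F p),
      (⋃ a : Fin ((i : ℕ) + 1 + 1), iota p (fun b => 𝔽.k (e b)) a (t i (e a) : 𝔽.k (e a)) •
          (normalizedPacket p (fun b => 𝔽.k (e b)) : Set (PacketAlgebra p (fun b => 𝔽.k (e b))))) ⊆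
        ((p : ℚ_[p]) ^ m i e) • (logPacket p (fun b => 𝔽.k (e b)) : Set (PacketAlgebra p (fun b => 𝔽.k (e b)))) ∧
      ¬ (⋃ a : Fin ((i : ℕ) + 1 + 1), iota p (fun b => 𝔽.k (e b)) a (t i (e a) : 𝔽.k (e a)) •
          (normalizedPacket p (fun b => 𝔽.k (e b)) : Set (PacketAlgebra p (fun b => 𝔽.k (e b))))) ⊆
        ((p : ℚ_[p]) ^ (m i e + 1)) •
          (logPacket p (fun b => 𝔽.k (e b)) : Set (PacketAlgebra p (fun b => 𝔽.k (e b))))) :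
    (realPrimePacketWith p 𝔽 c hc0 hcσ).negLogThetaAt lstar t =
      (1 / (lstar : ℝ)) * ∑ i : Fin lstar, ∑ e : Fin ((i : ℕ) + 1 + 1) → placesOver F p,
        (-(m i e * Real.log p) + packetLogμ p (fun b => 𝔽.k (e b))
          (packetHull p (fun b => 𝔽.k (e b))
            (logPacket p (fun b => 𝔽.k (e b)) : Set (PacketAlgebra p (fun b => 𝔽.k (e b)))))) *
          ∏ b, weight F (e b).1 := by
  unfold PrimePacket.negLogThetaAt PrimePacket.lnνLp PrimePacket.lnνTensorPower
  refine congrArg (fun x : ℝ => (1 / (lstar : ℝ)) * x) (Finset.sum_congr rfl fun i _ => ?_)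
  refine Finset.sum_congr rfl fun e _ => ?_
  obtain ⟨m', hm', hm1', -, -, hvol⟩ :=
    realPrimePacketWith_exists_content_logμ_possibleImagesHull p 𝔽 c hc0 hcσ t i e
  have hmm : m' = m i e := content_unique p (fun b => 𝔽.k (e b)) hm' hm1' (hm i e).1 (hm i e).2
  rw [hvol, hmm]

/-- **A content family EXISTS** (at every summand the slot union has a content). [cite: WeilBNT1967, Ch. II §2, Th. 2] -/
theorem exists_slotUnion_contentFamily {lstar : ℕ}
    (t : Fin lstar → (v : placesOver F p) → (𝔽.k v)ˣ) :
    ∃ m : (i : Fin lstar) → (Fin ((i : ℕ) + 1 + 1) → placesOver F p) → ℤ,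
      ∀ (i : Fin lstar) (e : Fin ((i : ℕ) + 1 + 1) → placesOver F p),
        (⋃ a : Fin ((i : ℕ) + 1 + 1), iota p (fun b => 𝔽.k (e b)) a (t i (e a) : 𝔽.k (e a)) •
            (normalizedPacket p (fun b => 𝔽.k (e b)) : Set (PacketAlgebra p (fun b => 𝔽.k (e b))))) ⊆
          ((p : ℚ_[p]) ^ m i e) •
            (logPacket p (fun b => 𝔽.k (e b)) : Set (PacketAlgebra p (fun b => 𝔽.k (e b)))) ∧
        ¬ (⋃ a : Fin ((i : ℕ) + 1 + 1), iota p (fun b => 𝔽.k (e b)) a (t i (e a) : 𝔽.k (e a)) •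
            (normalizedPacket p (fun b => 𝔽.k (e b)) : Set (PacketAlgebra p (fun b => 𝔽.k (e b))))) ⊆
          ((p : ℚ_[p]) ^ (m i e + 1)) •
            (logPacket p (fun b => 𝔽.k (e b)) : Set (PacketAlgebra p (fun b => 𝔽.k (e b)))) := by
  have h := fun (i : Fin lstar) (e : Fin ((i : ℕ) + 1 + 1) → placesOver F p) =>
    exists_content p (fun b => 𝔽.k (e b)) (isPsiBounded_slotUnion p 𝔽 t i e)
      (exists_ne_zero_mem_slotUnion p 𝔽 t i e)
  exact ⟨fun i e => (h i e).choose, fun i e => (h i e).choose_spec⟩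

/-- **The content family is UNIQUE** (two families satisfying the content conditions agree).
[cite: WeilBNT1967, Ch. II §2, Th. 2] -/
theorem slotUnion_contentFamily_unique {lstar : ℕ}
    (t : Fin lstar → (v : placesOver F p) → (𝔽.k v)ˣ)
    (m m' : (i : Fin lstar) → (Fin ((i : ℕ) + 1 + 1) → placesOver F p) → ℤ)
    (hm : ∀ (i : Fin lstar) (e : Fin ((i : ℕ) + 1 + 1) → placesOver F p),
      (⋃ a : Fin ((i : ℕ) + 1 + 1), iota p (fun b => 𝔽.k (e b)) a (t i (e a) : 𝔽.k (e a)) •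
          (normalizedPacket p (fun b => 𝔽.k (e b)) : Set (PacketAlgebra p (fun b => 𝔽.k (e b))))) ⊆
        ((p : ℚ_[p]) ^ m i e) • (logPacket p (fun b => 𝔽.k (e b)) : Set (PacketAlgebra p (fun b => 𝔽.k (e b)))) ∧
      ¬ (⋃ a : Fin ((i : ℕ) + 1 + 1), iota p (fun b => 𝔽.k (e b)) a (t i (e a) : 𝔽.k (e a)) •
          (normalizedPacket p (fun b => 𝔽.k (e b)) : Set (PacketAlgebra p (fun b => 𝔽.k (e b))))) ⊆
        ((p : ℚ_[p]) ^ (m i e + 1)) •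
          (logPacket p (fun b => 𝔽.k (e b)) : Set (PacketAlgebra p (fun b => 𝔽.k (e b)))))
    (hm' : ∀ (i : Fin lstar) (e : Fin ((i : ℕ) + 1 + 1) → placesOver F p),
      (⋃ a : Fin ((i : ℕ) + 1 + 1), iota p (fun b => 𝔽.k (e b)) a (t i (e a) : 𝔽.k (e a)) •
          (normalizedPacket p (fun b => 𝔽.k (e b)) : Set (PacketAlgebra p (fun b => 𝔽.k (e b))))) ⊆
        ((p : ℚ_[p]) ^ m' i e) • (logPacket p (fun b => 𝔽.k (e b)) : Set (PacketAlgebra p (fun b => 𝔽.k (e b)))) ∧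
      ¬ (⋃ a : Fin ((i : ℕ) + 1 + 1), iota p (fun b => 𝔽.k (e b)) a (t i (e a) : 𝔽.k (e a)) •
          (normalizedPacket p (fun b => 𝔽.k (e b)) : Set (PacketAlgebra p (fun b => 𝔽.k (e b))))) ⊆
        ((p : ℚ_[p]) ^ (m' i e + 1)) •
          (logPacket p (fun b => 𝔽.k (e b)) : Set (PacketAlgebra p (fun b => 𝔽.k (e b))))) :
    m = m' :=
  funext fun i => funext fun e =>
    content_unique p (fun b => 𝔽.k (e b)) (hm i e).1 (hm i e).2 (hm' i e).1 (hm' i e).2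

end RealPacketWith

end Literature.IUT.LogVolume

end
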